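import Summits.ResolutionOfSingularities.ResolutionOfSingularities.Theorems.EquisingularLiftEquisingularLiftNatVertexLineChartASections
import Summits.ResolutionOfSingularities.ResolutionOfSingularities.Theorems.EquisingularLiftEquisingularLiftNatVertexLineChartB
import Summits.ResolutionOfSingularities.ResolutionOfSingularities.Theorems.EquisingularLiftEquisingularLiftNatDirStepUnobsOfCharts
import Summits.ResolutionOfSingularities.ResolutionOfSingularities.Theorems.EquisingularLiftEquisingularLiftNatDirStepUnobsTwoChartSplit
import HarnessLib

/-!
# [OURS · L1 W4.5(b) · EL♮(3) · nose residue, D3-9 file 5/5] ★ The strict transform of a LINE through the blown-up vertex of `ℙ^{d+1}`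
# is UNOBSTRUCTED: `DirStepUnobs P̃ univ (vertexLineStrict b i₀)` — the Steiner LINE instance of the ν-socket

Crux chain w45b, child EL♮(3) = stmt-ResolutionOfSingularities-20148; desk table D3, row **D3-9** «Steiner LINE instances of `DirStepUnobs`»
(res-L1-w45b-nose-w3 g2; NOSE WORD v1.4 §3 row 1 (b); `L/res-L1-w45b-nose-w3/STEINER-TEST.md` (P4)). `--supports stmt-ResolutionOfSingularities-20148
--as helper`. OURS; NOT a statement of any manuscript; AI-written, weaker than expert review. No `sorry`; standard axioms; DEF-FREE (the de Jong
kit's `attribute [local instance] MvPolynomial.gradedAlgebra` is needed to write `Proj k[x]`). Resolution in positive characteristic is NOT proved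
here (dimension 3: Cossart–Piltant 2008/2009 in print); this is bookkeeping of OUR kernel-own route, counted 0.

★★ `dirStepUnobs_univ_vertexLineStrict` — for ANY blowing up `b : P̃ ⟶ ℙ^{d+1}_k = Proj k[x₀,…,x_{d+1}]` of the vertex `p = (0:…:0:1)` (`P̃` locally
Noetherian) and every `i₀ ≤ d`: the strict transform `Z′ = closure (b⁻¹(V₊(x_j : j ≤ d, j ≠ i₀) ∖ {p}))` of the line through `p` and `e_{i₀}`
satisfies `DirStepUnobs P̃ Set.univ isClosed_univ Z′ _` — `Ȟ¹(Z̃′, 𝒩_{Z̃′/P̃}) = 0` in the tree's Čech currency (`𝒩 ≅ 𝒪 ⊕ … ⊕ 𝒪`: the transition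
matrix between the two charts is `1`). For `d = 2` these are the three disjoint lines of the Steiner/Roman surface after its point step
(027's D3-9′ `dirStepUnobs_union_of_disjoint` turns them into the nose `Z′ = L₁′ ⊔ L₂′ ⊔ L₃′`).

ASSEMBLY (res-L1-w45b-nose-w1's producer ✓ `dirStepUnobs_univ_of_charts`, host `P̃`, `M = 1`): charts `A = c(Spec k[X][I/X_{i₀}])` (vertex chart,
✓ `…NatVertexLineChartA/Sections`) and `B = cB(Spec (k[x]_{(x_{i₀})})₀) = b⁻¹D₊(x_{i₀})` (✓ `…NatVertexLineChartB`); generators on both = restrictions of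
the SAME sections `lsRatio z i₀ (succAbove m)` (`hM` is transitivity of restriction); `A ∩ B = D(t)`, `t = b^*(x_{i₀}/x_{d+1})|_A`; cover
(`vertexLineStrict_subset_union`); and the ring-level TWISTED SPLITTING modulo `𝓘⟨Z′⟩` (`exists_split_mod_vanishingIdeal`): `Γ(A ∩ B) = Γ(A)[1/t]`,
`Γ(A) ≡ k[t] (mod 𝓘⟨Z′⟩(A))` (`exists_polynomial_sub_mem`), `t · w = 1` with `w = b^*(x_{d+1}/x_{i₀})|_B` (function-field identity
`mul_eq_one_of_ofSection`), Laurent monomials split (✓ `pow_mul_pow_eq_of_mul_eq_one`).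

References (index only): A. J. de Jong (1996), proof of Lemma 4.11 [cite: DeJong1996]; R. Hartshorne (1977), II §7, III.5 [cite: Hartshorne1977];
J. Lipman (1969), Prop. (1.2) A) p. 200 [cite: Lipman1969]; The Stacks Project, Tags 0804, 02OS, 01ED [cite: StacksProject].
-/

set_option linter.dupNamespace false -- mandated namespace `Summit.<Summit>.<Problem>` of this single-conjunct summit

noncomputable section

open CategoryTheory AlgebraicGeometry TopologicalSpace HomogeneousLocalization Topology Opposite
open Literature.AlgebraicGeometry.Resolution Literature.AlgebraicGeometry.Resolution.DeJong1996
open Literature.AlgebraicGeometry.Resolution.PointBlowup (Chart Base frac exc polyEquiv polyHom baseHom originIdeal)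
open Literature.AlgebraicGeometry.Motives.Segre (grading X_mem chartι toSpec)
open Literature.AlgebraicGeometry.Motives.RatFn

attribute [local instance] MvPolynomial.gradedAlgebra

namespace Summit.ResolutionOfSingularities.ResolutionOfSingularities.Cruxes.EquisingularLiftNat.Sections

/-! ## The twisted splitting modulo an ideal (Lipman's Laurent argument, abstract form) -/

/-- **Laurent splitting modulo ideals.** Opens `O ≤ W₀, W₁` of a scheme `Z`; `c ∈ Γ(W₀)`, `w ∈ Γ(W₁)` with `c|·w| = 1` on `O`; ideals `J₀ ⊆ Γ(W₀)`,
`J ⊆ Γ(O)` with `J₀| ⊆ J`; constants `κ₀ : R → Γ(W₀)`, `κ₁ : R → Γ(W₁)` agreeing on `O`; every `u ∈ Γ(O)` of the form `s|/c|^N`, and every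
`s ∈ Γ(W₀)` a polynomial in `c` with coefficients from `κ₀(R)` modulo `J₀`. Then every `u ∈ Γ(O)` is `v|_O + v'|_O` modulo `J`.
[cite: Lipman1969, Proposition (1.2), proof of statement A) (p. 200)] (OURS abstract spelling; the argument is Lipman's) -/
theorem exists_split_mod {Z : Scheme.{0}} {W₀ W₁ O : Z.Opens} (h₀ : O ≤ W₀) (h₁ : O ≤ W₁) (c : Γ(Z, W₀)) (w : Γ(Z, W₁))
    (hcw : Z.presheaf.map (homOfLE h₀).op c * Z.presheaf.map (homOfLE h₁).op w = 1)
    (J₀ : Ideal Γ(Z, W₀)) (J : Ideal Γ(Z, O)) (hJ : J₀.map (Z.presheaf.map (homOfLE h₀).op).hom ≤ J)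
    {R : Type} [CommRing R] (κ₀ : R →+* Γ(Z, W₀)) (κ₁ : R →+* Γ(Z, W₁))
    (hκ : ∀ a, Z.presheaf.map (homOfLE h₀).op (κ₀ a) = Z.presheaf.map (homOfLE h₁).op (κ₁ a))
    (hsurj : ∀ u : Γ(Z, O), ∃ (s : Γ(Z, W₀)) (N : ℕ), u * Z.presheaf.map (homOfLE h₀).op c ^ N = Z.presheaf.map (homOfLE h₀).op s)
    (hT : ∀ s : Γ(Z, W₀), ∃ p : Polynomial R, s - p.eval₂ κ₀ c ∈ J₀) (u : Γ(Z, O)) :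
    ∃ (v : Γ(Z, W₀)) (v' : Γ(Z, W₁)), u - (Z.presheaf.map (homOfLE h₀).op v + Z.presheaf.map (homOfLE h₁).op v') ∈ J := by
  set ρ₀ : Γ(Z, W₀) →+* Γ(Z, O) := (Z.presheaf.map (homOfLE h₀).op).hom with hρ₀
  set ρ₁ : Γ(Z, W₁) →+* Γ(Z, O) := (Z.presheaf.map (homOfLE h₁).op).hom with hρ₁
  change ρ₀ c * ρ₁ w = 1 at hcw
  change ∀ a, ρ₀ (κ₀ a) = ρ₁ (κ₁ a) at hκ
  change ∃ v v', u - (ρ₀ v + ρ₁ v') ∈ J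
  obtain ⟨s, N, hu⟩ := hsurj u
  change u * ρ₀ c ^ N = ρ₀ s at hu
  obtain ⟨p, hp⟩ := hT s
  -- `u = s| · w|^N`
  have hkey : u = ρ₀ s * ρ₁ w ^ N := by
    calc u = u * (ρ₀ c * ρ₁ w) ^ N := by rw [hcw, one_pow, mul_one]
      _ = u * ρ₀ c ^ N * ρ₁ w ^ N := by rw [mul_pow, mul_assoc]
      _ = ρ₀ s * ρ₁ w ^ N := by rw [hu]
  -- the polynomial part splits EXACTLY
  refine ⟨∑ i ∈ (Finset.range (p.natDegree + 1)).filter (fun i => ¬ i < N), κ₀ (p.coeff i) * c ^ (i - N),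
    ∑ i ∈ (Finset.range (p.natDegree + 1)).filter (fun i => i < N), κ₁ (p.coeff i) * w ^ (N - i), ?_⟩
  have hsplit : ρ₀ (p.eval₂ κ₀ c) * ρ₁ w ^ N =
      ρ₀ (∑ i ∈ (Finset.range (p.natDegree + 1)).filter (fun i => ¬ i < N), κ₀ (p.coeff i) * c ^ (i - N)) +
        ρ₁ (∑ i ∈ (Finset.range (p.natDegree + 1)).filter (fun i => i < N), κ₁ (p.coeff i) * w ^ (N - i)) := by
    rw [add_comm (ρ₀ _) (ρ₁ _), Polynomial.eval₂_eq_sum_range, map_sum, Finset.sum_mul, map_sum, map_sum,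
      ← Finset.sum_filter_add_sum_filter_not (Finset.range (p.natDegree + 1)) (fun i => i < N)]
    congr 1
    · refine Finset.sum_congr rfl fun i hi => ?_
      rw [Finset.mem_filter] at hi
      rw [map_mul, map_pow, mul_assoc, pow_mul_pow_eq_of_mul_eq_one hcw, if_pos hi.2, map_mul, map_pow, hκ]
    · refine Finset.sum_congr rfl fun i hi => ?_
      rw [Finset.mem_filter] at hi
      rw [map_mul, map_pow, mul_assoc, pow_mul_pow_eq_of_mul_eq_one hcw, if_neg hi.2, map_mul, map_pow]
  -- the error term lies in `J`
  have herr : ρ₀ (s - p.eval₂ κ₀ c) * ρ₁ w ^ N ∈ J :=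
    J.mul_mem_right _ (hJ (Ideal.mem_map_of_mem _ hp))
  have hrw : u - (ρ₀ (∑ i ∈ (Finset.range (p.natDegree + 1)).filter (fun i => ¬ i < N), κ₀ (p.coeff i) * c ^ (i - N)) +
      ρ₁ (∑ i ∈ (Finset.range (p.natDegree + 1)).filter (fun i => i < N), κ₁ (p.coeff i) * w ^ (N - i))) =
      ρ₀ (s - p.eval₂ κ₀ c) * ρ₁ w ^ N := by
    rw [← hsplit, hkey, map_sub, sub_mul]
  rw [hrw]
  exact herr

/-! ## The pieces of the certificate for the strict-transform line -/

section Line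

variable {d : ℕ} {k : Type} [Field k] {P : Scheme.{0}} (b : P ⟶ Proj (grading (Fin (d + 1 + 1)) k))
  (hb : IsBlowup b (vertexIdealSheaf d k)) (i₀ : Fin (d + 1))

/-- The constants: `k → Γ(Spec k, ⊤) → Γ(P̃, ⊤) → Γ(P̃, U)` along the structure morphism `P̃ → ℙ^{d+1} → Spec k`. [folklore] -/
theorem constants_map {U V : P.Opens} (hVU : V ≤ U) (a : k) :
    P.presheaf.map (homOfLE hVU).op
        ((P.presheaf.map (homOfLE (le_top : U ≤ ⊤)).op).hom
          (((b ≫ toSpec (Fin (d + 1 + 1)) k).appTop).hom ((Scheme.ΓSpecIso (.of k)).inv a))) =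
      (P.presheaf.map (homOfLE (le_top : V ≤ ⊤)).op).hom
        (((b ≫ toSpec (Fin (d + 1 + 1)) k).appTop).hom ((Scheme.ΓSpecIso (.of k)).inv a)) := by
  rw [← CommRingCat.comp_apply, ← Functor.map_comp]
  rfl

/-- **The constants read on the vertex chart are the constants of `Cᵢ₀`**: `θ (κ_A a) = algebraMap k Cᵢ₀ a` (the chart lies over `Spec k` through
`Spec` of the `k`-structure map of `Cᵢ₀`, ✓ `vertexChart_comp_comp_toSpec`). [folklore] -/
theorem chartRingEquiv_constant (a : k) :
    (Scheme.ΓSpecIso (.of (Chart d k i₀))).hom (((vertexChart hb i₀).appIso ⊤).hom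
      ((P.presheaf.map (homOfLE (le_top : vertexChart hb i₀ ''ᵁ ⊤ ≤ ⊤)).op).hom
        (((b ≫ toSpec (Fin (d + 1 + 1)) k).appTop).hom ((Scheme.ΓSpecIso (.of k)).inv a)))) =
      algebraMap k (Chart d k i₀) a := by
  have h1 : ((vertexChart hb i₀).appIso ⊤).hom ((P.presheaf.map (homOfLE (le_top : vertexChart hb i₀ ''ᵁ ⊤ ≤ ⊤)).op).hom
        (((b ≫ toSpec (Fin (d + 1 + 1)) k).appTop).hom ((Scheme.ΓSpecIso (.of k)).inv a))) =
      (vertexChart hb i₀).appTop (((b ≫ toSpec (Fin (d + 1 + 1)) k).appTop) ((Scheme.ΓSpecIso (.of k)).inv a)) := by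
    rw [Scheme.Hom.appIso_hom', ← CommRingCat.comp_apply, Scheme.Hom.map_appLE,
      Literature.AlgebraicGeometry.Motives.GeneratingSections.appLE_top_top]
  have h2 : (vertexChart hb i₀).appTop (((b ≫ toSpec (Fin (d + 1 + 1)) k).appTop) ((Scheme.ΓSpecIso (.of k)).inv a)) =
      (vertexChart hb i₀ ≫ b ≫ toSpec (Fin (d + 1 + 1)) k).appTop ((Scheme.ΓSpecIso (.of k)).inv a) := by
    rw [Scheme.Hom.comp_appTop]; rfl
  have h3 := congrArg (fun φ => φ.hom ((Scheme.ΓSpecIso (.of k)).inv a))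
    (Scheme.ΓSpecIso_naturality (CommRingCat.ofHom (algebraMap k (Chart d k i₀))))
  simp only [CommRingCat.hom_comp, RingHom.comp_apply, CommRingCat.hom_ofHom] at h3
  rw [h1, h2, vertexChart_comp_comp_toSpec b hb i₀, h3, Iso.inv_hom_id_apply]

variable [IsIntegral P] [IsDominant b]

omit [IsIntegral P] [IsDominant b] in
/-- **`Γ(A) ≡ k[t] (mod 𝓘⟨Z′⟩(A))`**: every section over the vertex chart is, modulo the ideal of the strict-transform line, a polynomial in the
coordinate `t = b^*(x_{i₀}/x_{d+1})|_A` with constant coefficients (`Cᵢ₀ ≅ k[Y][T]`, `Y ↦ 0` kills exactly `𝔮`). [cite: Hartshorne1977, II §7]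
(OURS computation; folklore) -/
theorem exists_polynomial_sub_mem (g : Γ(P, vertexChart hb i₀ ''ᵁ ⊤)) :
    ∃ p : Polynomial k,
      g - p.eval₂ ((P.presheaf.map (homOfLE (le_top : vertexChart hb i₀ ''ᵁ ⊤ ≤ ⊤)).op).hom.comp
          (((b ≫ toSpec (Fin (d + 1 + 1)) k).appTop).hom.comp (Scheme.ΓSpecIso (.of k)).inv.hom))
        (P.presheaf.map (homOfLE (image_top_le_preimage_lastChart b hb i₀)).op (blowupSection b i₀)) ∈
      (Scheme.IdealSheafData.vanishingIdeal ⟨vertexLineStrict b i₀, isClosed_vertexLineStrict b i₀⟩).ideal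
        ⟨vertexChart hb i₀ ''ᵁ ⊤, isAffineOpen_image_top (vertexChart hb i₀)⟩ := by
  classical
  set θ : Γ(P, vertexChart hb i₀ ''ᵁ ⊤) ≃+* Chart d k i₀ :=
    ((vertexChart hb i₀).appIso ⊤ ≪≫ Scheme.ΓSpecIso (.of (Chart d k i₀))).commRingCatIsoToRingEquiv with hθ
  set κ : k →+* Γ(P, vertexChart hb i₀ ''ᵁ ⊤) := (P.presheaf.map (homOfLE (le_top : vertexChart hb i₀ ''ᵁ ⊤ ≤ ⊤)).op).hom.comp
    (((b ≫ toSpec (Fin (d + 1 + 1)) k).appTop).hom.comp (Scheme.ΓSpecIso (.of k)).inv.hom) with hκ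
  set t := P.presheaf.map (homOfLE (image_top_le_preimage_lastChart b hb i₀)).op (blowupSection b i₀) with ht
  have hθκ : (θ : Γ(P, vertexChart hb i₀ ''ᵁ ⊤) →+* Chart d k i₀).comp κ = algebraMap k (Chart d k i₀) :=
    RingHom.ext fun a => chartRingEquiv_constant b hb i₀ a
  have hθt : (θ : Γ(P, vertexChart hb i₀ ''ᵁ ⊤) →+* Chart d k i₀) t = exc d k i₀ := chartRingEquiv_blowupSection b hb i₀
  -- the ideal through the chart
  rw [vanishingIdeal_ideal_image_eq_comap (vertexChart hb i₀) ⟨vertexLineStrict b i₀, isClosed_vertexLineStrict b i₀⟩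
    (Ideal.span (frac d k i₀ '' {i₀}ᶜ)) (isPrime_span_frac i₀).isRadical (preimage_vertexChart_vertexLineStrict hb i₀)]
  change ∃ p : Polynomial k, g - _ ∈ Ideal.comap (θ : Γ(P, vertexChart hb i₀ ''ᵁ ⊤) →+* Chart d k i₀) _
  -- the polynomial: the `Y = 0` part of `θ g ∈ k[Y][T]`
  let G : MvPolynomial Unit (Base d k i₀) := (polyEquiv d k i₀).symm (θ g)
  refine ⟨∑ s ∈ G.support, Polynomial.monomial (s ()) (MvPolynomial.constantCoeff (G.coeff s)), ?_⟩
  rw [Ideal.mem_comap, map_sub, Polynomial.hom_eval₂, hθκ, hθt, Polynomial.eval₂_finsetSum]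
  simp only [Polynomial.eval₂_monomial]
  -- `θ g = Σ_s baseHom (coeff s G) · exc^(s ())`
  have hg : (θ : Γ(P, vertexChart hb i₀ ''ᵁ ⊤) →+* Chart d k i₀) g = ∑ s ∈ G.support, baseHom d k i₀ (G.coeff s) * exc d k i₀ ^ (s ()) := by
    have h1 : (θ : Γ(P, vertexChart hb i₀ ''ᵁ ⊤) →+* Chart d k i₀) g = polyEquiv d k i₀ G := by
      change θ g = _; rw [RingEquiv.apply_symm_apply]
    rw [h1, PointBlowup.polyEquiv_apply]
    conv_lhs => rw [G.as_sum]
    rw [map_sum]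
    refine Finset.sum_congr rfl fun s _ => ?_
    rw [PointBlowup.polyHom, MvPolynomial.eval₂Hom_monomial, Finsupp.prod_fintype _ _ (fun _ => pow_zero _)]
    simp only [Finset.univ_unique, Finset.prod_singleton, AlgHom.toRingHom_eq_coe, RingHom.coe_coe]
  rw [hg, ← Finset.sum_sub_distrib]
  refine Ideal.sum_mem _ fun s _ => ?_
  rw [← sub_mul]
  refine Ideal.mul_mem_right _ _ ?_
  -- `baseHom (coeff) - algebraMap k C (cc coeff) = baseHom (coeff - C (cc coeff)) ∈ 𝔮`
  rw [← PointBlowup.baseHom_C, ← map_sub]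
  have hker : G.coeff s - MvPolynomial.C (MvPolynomial.constantCoeff (G.coeff s)) ∈
      Ideal.span (Set.range (MvPolynomial.X : {j : Fin (d + 1) // j ≠ i₀} → Base d k i₀)) := by
    rw [← ker_constantCoeff_eq_span_X, RingHom.mem_ker, map_sub, MvPolynomial.constantCoeff_C, sub_self]
  have hmap : Ideal.map (baseHom d k i₀ : Base d k i₀ →+* Chart d k i₀)
      (Ideal.span (Set.range (MvPolynomial.X : {j : Fin (d + 1) // j ≠ i₀} → Base d k i₀))) ≤ Ideal.span (frac d k i₀ '' {i₀}ᶜ) := by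
    rw [Ideal.map_span, Ideal.span_le]
    rintro _ ⟨_, ⟨j, rfl⟩, rfl⟩
    refine Ideal.subset_span ⟨j.1, j.2, ?_⟩
    exact (PointBlowup.baseHom_X d k i₀ j).symm
  exact hmap (Ideal.mem_map_of_mem _ hker)

/-- **`t · w = 1` on the overlap**: `b^*(x_{i₀}/x_{d+1})|_O · b^*(x_{d+1}/x_{i₀})|_O = 1` for every open `O ⊆ A ∩ b⁻¹D₊(x_{i₀})` containing the
generic point (both sides have the same rational function: `z_{i₀} · b^*(x_{d+1}/x_{i₀}) = b^*(1) = 1`). [folklore] -/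
theorem blowupSection_mul_ratio_eq_one {O : P.Opens} (hO₀ : O ≤ b ⁻¹ᵁ (lastChart d k : (Proj (grading (Fin (d + 1 + 1)) k)).Opens))
    (hO₁ : O ≤ b ⁻¹ᵁ (gensP d k).U (Fin.castSucc i₀)) (hη : genericPoint P ∈ O) :
    P.presheaf.map (homOfLE hO₀).op (blowupSection b i₀) *
        P.presheaf.map (homOfLE hO₁).op (b.app ((gensP d k).U (Fin.castSucc i₀)) ((gensP d k).ratio (Fin.castSucc i₀) (Fin.last (d + 1)))) = 1 := by
  have e1 : ofSection hη (P.presheaf.map (homOfLE hO₀).op (blowupSection b i₀)) = blowupRatFn b i₀ :=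
    (ofSection_map (homOfLE hO₀) hη (blowupSection b i₀)).trans (ofSection_blowupSection b i₀)
  have e2 : ofSection hη (P.presheaf.map (homOfLE hO₁).op
      (b.app ((gensP d k).U (Fin.castSucc i₀)) ((gensP d k).ratio (Fin.castSucc i₀) (Fin.last (d + 1))))) =
      functionFieldMap b ((gensP d k).ratioFn (Fin.castSucc i₀) (Fin.last (d + 1))
        (Literature.AlgebraicGeometry.Motives.ProjSpace.genericPoint_mem_U (Fin.castSucc i₀))) :=
    (ofSection_map (homOfLE hO₁) hη _).trans
      (ofSection_app_eq b (Literature.AlgebraicGeometry.Motives.ProjSpace.genericPoint_mem_U (Fin.castSucc i₀)) _)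
  apply ofSection_injective hη
  rw [ofSection_mul, ofSection_one, e1, e2]
  change functionFieldMap b (vertexRatFn d k i₀) *
    functionFieldMap b ((gensP d k).ratioFn (Fin.castSucc i₀) (Fin.last (d + 1))
      (Literature.AlgebraicGeometry.Motives.ProjSpace.genericPoint_mem_U (Fin.castSucc i₀))) = 1
  rw [← map_mul, vertexRatFn, (gensP d k).ratioFn_mul_ratioFn, (gensP d k).ratioFn_self, map_one]

omit [IsIntegral P] [IsDominant b] in
/-- **The strict-transform line is covered by the two charts** `A = c(Spec Cᵢ₀)` and `b⁻¹D₊(x_{i₀})`. [folklore] -/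
theorem vertexLineStrict_subset_union :
    vertexLineStrict b i₀ ⊆ ((vertexChart hb i₀ ''ᵁ ⊤ : P.Opens) : Set P) ∪
      ((b ⁻¹ᵁ Proj.basicOpen (grading (Fin (d + 1 + 1)) k) (MvPolynomial.X (Fin.castSucc i₀)) : P.Opens) : Set P) := by
  intro z hz
  rcases mem_preimage_basicOpen_or_mem_opensRange hb z with ⟨j, hj⟩ | ⟨i, hi⟩
  · -- over `D₊(x_j)`: `j = i₀` since the other `x_j` vanish on the line
    have hzL : b z ∈ vertexLine d k i₀ := vertexLineStrict_subset_preimage b i₀ hz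
    by_cases hji : j = i₀
    · subst hji
      exact Or.inr hj
    · exact absurd (hzL j hji) ((Proj.mem_basicOpen _ _ _).mp hj)
  · by_cases hii : i = i₀
    · subst hii
      left
      rw [Scheme.Hom.image_top_eq_opensRange]
      exact hi
    · obtain ⟨𝔭, rfl⟩ := hi
      have h𝔭 : 𝔭 ∈ (vertexChart hb i) ⁻¹' vertexLineStrict b i₀ := hz
      rw [preimage_vertexChart_vertexLineStrict_of_ne hb i₀ hii] at h𝔭
      exact absurd h𝔭 (Set.notMem_empty 𝔭)

/-! ## ★★ The certificate -/

set_option maxHeartbeats 400000 in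
omit [IsIntegral P] [IsDominant b] in
include hb in
/-- ★★ **The strict transform of a line through the blown-up vertex is UNOBSTRUCTED.** For ANY blowing up `b : P̃ ⟶ ℙ^{d+1}_k` of the vertex
`p = (0:…:0:1)` (`P̃` locally Noetherian) and every `i₀ ≤ d`, the strict transform `Z′` of the line `V₊(x_j : j ≤ d, j ≠ i₀)` through `p`
and `e_{i₀}` satisfies the ν-socket's clause `DirStepUnobs P̃ univ Z′`: `Ȟ¹(Z̃′, 𝒩_{Z̃′/P̃}) = 0` on the two charts `c(Spec k[X][I/X_{i₀}])`,
`b⁻¹D₊(x_{i₀})` (res-L1-w45b-nose-w1's producer ✓ `dirStepUnobs_univ_of_charts` with transition matrix `1`). For `d = 2` these are the three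
double lines of Steiner's Roman surface after its point step (NOSE WORD v1.4 §3 row 1 (b); the union is 027's D3-9′).
[OURS · L1 W4.5b · EL♮(3) · nose residue D3-9; NOT a statement of the manuscript; resolution in char p NOT proved here] -/
theorem dirStepUnobs_univ_vertexLineStrict [IsLocallyNoetherian P] :
    DirStepUnobs P Set.univ isClosed_univ (vertexLineStrict b i₀) (isClosed_vertexLineStrict b i₀) := by
  classical
  haveI : IsIntegral P := isIntegral_of_isBlowup_vertex hb
  haveI : IsDominant b := isDominant_of_isBlowup_vertex hb
  obtain ⟨cB, hcBo, hcB, hcBim⟩ := exists_lift_of_isBlowup_vertex b hb i₀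
  -- the two charts, the generators, the coordinate and its inverse, the constants
  let UA : P.affineOpens := ⟨vertexChart hb i₀ ''ᵁ ⊤, isAffineOpen_image_top (vertexChart hb i₀)⟩
  let UB : P.affineOpens := ⟨cB ''ᵁ ⊤, isAffineOpen_image_top cB⟩
  let U : Fin 2 → P.affineOpens := ![UA, UB]
  set xA : Fin d → Γ(P, vertexChart hb i₀ ''ᵁ ⊤) := fun m =>
    P.presheaf.map (homOfLE (image_top_le_lsChart b hb i₀)).op (lsRatio (blowupRatFn b) i₀ (i₀.succAbove m)) with hxA
  set xB : Fin d → Γ(P, cB ''ᵁ ⊤) := fun m =>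
    P.presheaf.map (homOfLE (image_top_le_lsChart_B i₀ cB hcB)).op (lsRatio (blowupRatFn b) i₀ (i₀.succAbove m)) with hxB
  let x : (i : Fin 2) → Fin d → Γ(P, (U i : P.Opens)) := Fin.cons xA (Fin.cons xB finZeroElim)
  set tA : Γ(P, vertexChart hb i₀ ''ᵁ ⊤) := P.presheaf.map (homOfLE (image_top_le_preimage_lastChart b hb i₀)).op (blowupSection b i₀)
    with htA
  have hBle : cB ''ᵁ ⊤ ≤ b ⁻¹ᵁ (gensP d k).U (Fin.castSucc i₀) := image_top_le_preimage_basicOpen i₀ cB hcB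
  set wB : Γ(P, cB ''ᵁ ⊤) := P.presheaf.map (homOfLE hBle).op
    (b.app ((gensP d k).U (Fin.castSucc i₀)) ((gensP d k).ratio (Fin.castSucc i₀) (Fin.last (d + 1)))) with hwB
  let κ : ∀ W : P.Opens, k →+* Γ(P, W) := fun W =>
    (P.presheaf.map (homOfLE (le_top : W ≤ ⊤)).op).hom.comp
      (((b ≫ toSpec (Fin (d + 1 + 1)) k).appTop).hom.comp (Scheme.ΓSpecIso (.of k)).inv.hom)
  -- the overlap is the basic open of the coordinate
  have hO : vertexChart hb i₀ ''ᵁ ⊤ ⊓ cB ''ᵁ ⊤ = P.basicOpen tA := by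
    rw [hcBim, image_top_inf_preimage_basicOpen_eq]
  have h01 : IsAffineOpen (vertexChart hb i₀ ''ᵁ ⊤ ⊓ cB ''ᵁ ⊤) := by
    rw [hO]; exact (isAffineOpen_image_top (vertexChart hb i₀)).basicOpen tA
  have hη : genericPoint P ∈ vertexChart hb i₀ ''ᵁ ⊤ ⊓ cB ''ᵁ ⊤ :=
    ⟨genericPoint_mem_image_top b hb i₀,
      hcBim ▸ genericPoint_mem_preimage b (Literature.AlgebraicGeometry.Motives.ProjSpace.genericPoint_mem_U (Fin.castSucc i₀))⟩
  -- `t · w = 1` on the overlap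
  have hcw : P.presheaf.map (homOfLE (inf_le_left : vertexChart hb i₀ ''ᵁ ⊤ ⊓ cB ''ᵁ ⊤ ≤ _)).op tA *
      P.presheaf.map (homOfLE (inf_le_right : vertexChart hb i₀ ''ᵁ ⊤ ⊓ cB ''ᵁ ⊤ ≤ _)).op wB = 1 := by
    have h := blowupSection_mul_ratio_eq_one b i₀ (O := vertexChart hb i₀ ''ᵁ ⊤ ⊓ cB ''ᵁ ⊤)
      (inf_le_left.trans (image_top_le_preimage_lastChart b hb i₀)) (inf_le_right.trans hBle) hη
    refine Eq.trans ?_ h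
    have e_t : P.presheaf.map (homOfLE (inf_le_left : vertexChart hb i₀ ''ᵁ ⊤ ⊓ cB ''ᵁ ⊤ ≤ _)).op tA =
        P.presheaf.map (homOfLE (inf_le_left.trans (image_top_le_preimage_lastChart b hb i₀))).op (blowupSection b i₀) := by
      rw [htA]
      generalize blowupSection b i₀ = σ
      rw [← CommRingCat.comp_apply, ← Functor.map_comp]
      rfl
    have e_w : P.presheaf.map (homOfLE (inf_le_right : vertexChart hb i₀ ''ᵁ ⊤ ⊓ cB ''ᵁ ⊤ ≤ _)).op wB =
        P.presheaf.map (homOfLE (inf_le_right.trans hBle)).op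
          (b.app ((gensP d k).U (Fin.castSucc i₀)) ((gensP d k).ratio (Fin.castSucc i₀) (Fin.last (d + 1)))) := by
      rw [hwB]
      generalize b.app ((gensP d k).U (Fin.castSucc i₀)) ((gensP d k).ratio (Fin.castSucc i₀) (Fin.last (d + 1))) = τ
      rw [← CommRingCat.comp_apply, ← Functor.map_comp]
      rfl
    rw [e_t, e_w]
  -- every section over the overlap is `s| / t|^N`
  have hsurj : ∀ u : Γ(P, vertexChart hb i₀ ''ᵁ ⊤ ⊓ cB ''ᵁ ⊤), ∃ (s : Γ(P, vertexChart hb i₀ ''ᵁ ⊤)) (N : ℕ),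
      u * P.presheaf.map (homOfLE inf_le_left).op tA ^ N = P.presheaf.map (homOfLE inf_le_left).op s := by
    intro u
    letI := (P.presheaf.map (homOfLE (inf_le_left : vertexChart hb i₀ ''ᵁ ⊤ ⊓ cB ''ᵁ ⊤ ≤ vertexChart hb i₀ ''ᵁ ⊤)).op).hom.toAlgebra
    haveI := (isAffineOpen_image_top (vertexChart hb i₀)).isLocalization_of_eq_basicOpen tA
      (homOfLE (inf_le_left : vertexChart hb i₀ ''ᵁ ⊤ ⊓ cB ''ᵁ ⊤ ≤ vertexChart hb i₀ ''ᵁ ⊤)) hO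
    obtain ⟨⟨s, ⟨_, N, rfl⟩⟩, hs⟩ := IsLocalization.surj (Submonoid.powers tA) u
    refine ⟨s, N, ?_⟩
    have hs' : u * (P.presheaf.map (homOfLE (inf_le_left : vertexChart hb i₀ ''ᵁ ⊤ ⊓ cB ''ᵁ ⊤ ≤ vertexChart hb i₀ ''ᵁ ⊤)).op).hom
        (tA ^ N) = (P.presheaf.map (homOfLE inf_le_left).op).hom s := hs
    rwa [map_pow] at hs'
  -- the generators agree on the overlap (transition matrix `1`)
  have hagree : ∀ m, P.presheaf.map (homOfLE (inf_le_left : vertexChart hb i₀ ''ᵁ ⊤ ⊓ cB ''ᵁ ⊤ ≤ _)).op (xA m) =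
      P.presheaf.map (homOfLE (inf_le_right : vertexChart hb i₀ ''ᵁ ⊤ ⊓ cB ''ᵁ ⊤ ≤ _)).op (xB m) := fun m => by
    rw [hxA, hxB]
    change P.presheaf.map _ (P.presheaf.map _ (lsRatio (blowupRatFn b) i₀ (i₀.succAbove m))) =
      P.presheaf.map _ (P.presheaf.map _ (lsRatio (blowupRatFn b) i₀ (i₀.succAbove m)))
    generalize lsRatio (blowupRatFn b) i₀ (i₀.succAbove m) = σ
    rw [← CommRingCat.comp_apply, ← Functor.map_comp, ← CommRingCat.comp_apply, ← Functor.map_comp]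
    rfl
  -- ASSEMBLY
  refine dirStepUnobs_univ_of_charts P (vertexLineStrict b i₀) (isClosed_vertexLineStrict b i₀) U h01 ?_ x
    (Fin.forall_fin_two.mpr ⟨isQuasiRegular_lsRatio b hb i₀, isQuasiRegular_lsRatio_B i₀ cB hcB⟩)
    (Fin.forall_fin_two.mpr ⟨span_lsRatio_eq_vanishingIdeal b hb i₀, span_lsRatio_eq_vanishingIdeal_B i₀ cB hcB⟩)
    (fun m j => if m = j then 1 else 0) ?_ ?_
  · -- cover
    change vertexLineStrict b i₀ ⊆ ((vertexChart hb i₀ ''ᵁ ⊤ : P.Opens) : Set P) ∪ ((cB ''ᵁ ⊤ : P.Opens) : Set P)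
    rw [hcBim]
    exact vertexLineStrict_subset_union b hb i₀
  · -- transition matrix `1`
    intro m
    simp only [ite_mul, one_mul, zero_mul, Finset.sum_ite_eq, Finset.mem_univ, if_true]
    exact hagree m
  · -- the twisted splitting modulo `𝓘⟨Z′⟩`
    intro c
    have hsplit := fun m => exists_split_mod (Z := P) (inf_le_left : vertexChart hb i₀ ''ᵁ ⊤ ⊓ cB ''ᵁ ⊤ ≤ _)
      (inf_le_right : vertexChart hb i₀ ''ᵁ ⊤ ⊓ cB ''ᵁ ⊤ ≤ _) tA wB hcw
      ((Scheme.IdealSheafData.vanishingIdeal ⟨vertexLineStrict b i₀, isClosed_vertexLineStrict b i₀⟩).ideal UA)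
      ((Scheme.IdealSheafData.vanishingIdeal ⟨vertexLineStrict b i₀, isClosed_vertexLineStrict b i₀⟩).ideal
        ⟨vertexChart hb i₀ ''ᵁ ⊤ ⊓ cB ''ᵁ ⊤, h01⟩)
      (Scheme.IdealSheafData.map_ideal _ (show (⟨vertexChart hb i₀ ''ᵁ ⊤ ⊓ cB ''ᵁ ⊤, h01⟩ : P.affineOpens) ≤ UA from
        fun x hx => hx.1)).le
      (κ _) (κ _) (fun a => by
        simp only [κ, RingHom.comp_apply]
        rw [constants_map b, constants_map b])
      hsurj (exists_polynomial_sub_mem b hb i₀) (c m)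
    choose v₀ v₁ hv using hsplit
    refine ⟨Fin.cons v₀ (Fin.cons v₁ finZeroElim), fun m => ?_⟩
    simp only [ite_mul, one_mul, zero_mul, Finset.sum_ite_eq, Finset.mem_univ, if_true]
    exact hv m

end Line

end Summit.ResolutionOfSingularities.ResolutionOfSingularities.Cruxes.EquisingularLiftNat.Sections

end
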